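import Literature.AlgebraicGeometry.HodgeTheory.AbelianVarietyEllipticCurveAutomorphismGroup
import HarnessLib

/-!
# Fixed points of automorphisms of a complex elliptic curve: `#Fix(u) = |Ker(1 − u)(ℂ)| = 2 − tr(u^* | H¹(E(ℂ); ℤ))`, and the table `4, 2, 1, 3, 0`

Layer `Literature/AlgebraicGeometry/HodgeTheory`, namespace `Literature.AlgebraicGeometry.HodgeTheory` (theorems in the `AbelianVariety`
namespace).  THEOREMS ONLY (no definition, no named fact, no instance, no notation; D-0026 net debt 0).  `E` is a `Motives.AbelianVariety ℂ`
of dimension `1`, `Aut(E) = (End E)ˣ`, and the fixed points of `u ∈ Aut(E)` are the complex points of `Ker(1 − u)`; they are COUNTED by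
`Nat.card`, which is `0` for an infinite set — Alvarado–Auffarth's convention «`#Fix(f)` … the number of fixed points of `f` if this number is
finite, and `0` if not».  `t(u) = tr(u^* | H¹(E(ℂ); ℤ)) ∈ {2, −2, 0, 1, −1}` (prequels).

## Sources, VERBATIM

* M. Alvarado, R. Auffarth, *Fixed points of endomorphisms of complex tori*, J. Algebra 507 (2018) [AlvaradoAuffarth2018] (held
  `paper:arxiv-1705.09681`, p0003 read): «`F(n) := #Fix(fⁿ)` denote the number of fixed points of `fⁿ` if this number is finite, and `0` if not.
  … the Lefschetz Fixed-Point Theorem for complex tori gives the exact number of fixed points of `f` … (1) `#Fix(fⁿ) = |∏_{i=1}^g (1 − λᵢⁿ)|²`»;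
  «THEOREM 1.1 … `#Fix(fⁿ)` has one of the following behaviors: … It is a periodic function, and the non-zero eigenvalues of `f` are `k`-th roots
  of unity …».  For `g = 1` and an automorphism `u` with eigenvalue `λ` (`|λ| = 1`): `#Fix(u) = |1 − λ|² = 2 − (λ + λ̄) = 2 − t(u)`.
* I. Farmakis, M. Moskowitz, *Fixed Point Theorems and Their Applications* (2013), §5.5.2 [FarmakisMoskowitz2013]: the Lefschetz number
  `L(f) = Σ (−1)^i Tr(f^{*,i})`; here `L(u) = 1 − t(u) + deg u = 2 − t(u)`.
* J. H. Silverman, *The Arithmetic of Elliptic Curves* [SilvermanAEC2009], III §10 Thm. 10.1 (`Aut(E)` cyclic of order `2, 4, 6`).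

## What is proved (`A` with `dim A = 1`, `u : (End A)ˣ`; `Fix(u) := Ker(1 − u)(ℂ)`)

* **`natCard_kerPoints_one_sub_units`** (`#Fix(u) = 2 − t(u)` in `ℤ`, for EVERY automorphism, `u = 1` included),
  **`natCard_kerPoints_one_sub_neg_one_units`** (`#Fix(−1) = 4`: the `2`-torsion), **`natCard_kerPoints_one_sub_units_of_trace_eq_zero`** (`i ↦ 2`),
  **`…_of_trace_eq_one`** (`ζ₆ ↦ 1`), **`…_of_trace_eq_neg_one`** (`ζ₃ ↦ 3`), `natCard_kerPoints_one_sub_one_units` (`1 ↦ 0`),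
  **`natCard_kerPoints_one_sub_units_eq_zero_iff`** (`#Fix(u) = 0 ↔ u = 1`), `one_le_natCard_kerPoints_one_sub_units` (`u ≠ 1 ⇒ #Fix(u) ≥ 1`),
  `natCard_kerPoints_one_sub_units_le_four`, `natCard_kerPoints_one_sub_units_inv` (`#Fix(u⁻¹) = #Fix(u)`),
  `natCard_kerPoints_one_sub_units_add_neg` (`#Fix(u) + #Fix(−u) = 4`), `natCard_kerPoints_one_sub_units_mem` (`∈ {0, 1, 2, 3, 4}`).

## SCOPE

(a) Only automorphisms of elliptic curves (the general torus formula (1) is the tree's `AbelianVarietyLefschetzFixedPointFormula`); no iterates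
beyond what `u¹² = 1` gives trivially.  (b) Nothing here is a case of the Hodge conjecture.

## References

* [AlvaradoAuffarth2018] M. Alvarado, R. Auffarth, *Fixed points of endomorphisms of complex tori*, J. Algebra 507 (2018) 428–441 — §1 eq. (1),
  Thm. 1.1 (arXiv 1705.09681, p. 3).
* [FarmakisMoskowitz2013] I. Farmakis, M. Moskowitz, *Fixed Point Theorems and Their Applications*, World Scientific 2013 — §5.5.2.
* [SilvermanAEC2009] J. H. Silverman, *The Arithmetic of Elliptic Curves*, 2nd ed., GTM 106, Springer 2009 — III §10 Thm. 10.1.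

## Provenance

lit-hodgefound prover seat p21, generation 46, row g46-#15 (own row, claimed by path; sequel of g46-#1, g46-#12, g46-#13).
-/

open Function CategoryTheory Module
open Literature.AlgebraicTopology.SingularHomology

universe u

namespace Literature.AlgebraicGeometry.HodgeTheory

namespace AbelianVariety

open _root_.AlgebraicGeometry
open Literature.AlgebraicGeometry.Motives
open Literature.AlgebraicGeometry.Motives.AbelianVariety

variable {A : Motives.AbelianVariety ℂ}

section DimOne

variable (hA : A.dim = 1)
include hA

/-- **`#Fix(u) = |Ker(1 − u)(ℂ)| = 2 − tr(u^* | H¹(E(ℂ); ℤ))` for EVERY automorphism `u` of a complex elliptic curve** (`= 1 − t(u) + deg u` with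
`deg u = 1`; for `u = 1` both sides are `0`, the kernel `E(ℂ)` being infinite). [cite: AlvaradoAuffarth2018, §1 eq. (1) (`#Fix(f) = |1 − λ|²` for `g = 1`)]
[cite: FarmakisMoskowitz2013, §5.5.2] -/
theorem natCard_kerPoints_one_sub_units (u : (End A)ˣ) :
    (Nat.card (Hom.kerPoints (specOver ℂ ℂ) ((1 : End A) - (u : End A))) : ℤ) =
      2 - LinearMap.trace ℤ _ (singularCohomology.map ℤ ℤ (AlgPoints.mapContinuous (L := ℂ) (u : End A).hom.hom.hom) 1).hom := by
  have h := natCard_kerPoints_id_sub_eq_of_dim_eq_one hA (u : End A)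
  rw [det_singularCohomology_map_one_units] at h
  -- `(1 : End A) - u` is `𝟙 A - u` definitionally
  exact h.trans (by ring)

/-- **`#Fix(−1) = 4`: the fixed points of `−1` are the `2`-torsion points** (`t(−1) = −2`). [cite: AlvaradoAuffarth2018, §1 eq. (1)] [cite: SilvermanAEC2009, III §10 Thm. 10.1] -/
theorem natCard_kerPoints_one_sub_neg_one_units :
    Nat.card (Hom.kerPoints (specOver ℂ ℂ) ((1 : End A) - ((-1 : (End A)ˣ) : End A))) = 4 := by
  have h := natCard_kerPoints_one_sub_units hA (-1)
  rw [trace_units_neg_one hA] at h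
  omega

/-- **`#Fix(i) = 2` for an automorphism of trace `0`** (`i² = −1`; `|1 − i|² = 2`). [cite: AlvaradoAuffarth2018, §1 eq. (1)] [cite: SilvermanAEC2009, III §10 Thm. 10.1] -/
theorem natCard_kerPoints_one_sub_units_of_trace_eq_zero (u : (End A)ˣ)
    (hu : LinearMap.trace ℤ _ (singularCohomology.map ℤ ℤ (AlgPoints.mapContinuous (L := ℂ) (u : End A).hom.hom.hom) 1).hom = 0) :
    Nat.card (Hom.kerPoints (specOver ℂ ℂ) ((1 : End A) - (u : End A))) = 2 := by
  have h := natCard_kerPoints_one_sub_units hA u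
  rw [hu] at h
  omega

/-- **`#Fix(ζ₆) = 1` for an automorphism of trace `1`** (only the origin; `|1 − ζ₆|² = 1`). [cite: AlvaradoAuffarth2018, §1 eq. (1)] [cite: SilvermanAEC2009, III §10 Thm. 10.1] -/
theorem natCard_kerPoints_one_sub_units_of_trace_eq_one (u : (End A)ˣ)
    (hu : LinearMap.trace ℤ _ (singularCohomology.map ℤ ℤ (AlgPoints.mapContinuous (L := ℂ) (u : End A).hom.hom.hom) 1).hom = 1) :
    Nat.card (Hom.kerPoints (specOver ℂ ℂ) ((1 : End A) - (u : End A))) = 1 := by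
  have h := natCard_kerPoints_one_sub_units hA u
  rw [hu] at h
  omega

/-- **`#Fix(ζ₃) = 3` for an automorphism of trace `−1`** (`|1 − ζ₃|² = 3`). [cite: AlvaradoAuffarth2018, §1 eq. (1)] [cite: SilvermanAEC2009, III §10 Thm. 10.1] -/
theorem natCard_kerPoints_one_sub_units_of_trace_eq_neg_one (u : (End A)ˣ)
    (hu : LinearMap.trace ℤ _ (singularCohomology.map ℤ ℤ (AlgPoints.mapContinuous (L := ℂ) (u : End A).hom.hom.hom) 1).hom = -1) :
    Nat.card (Hom.kerPoints (specOver ℂ ℂ) ((1 : End A) - (u : End A))) = 3 := by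
  have h := natCard_kerPoints_one_sub_units hA u
  rw [hu] at h
  omega

/-- `#Fix(1) = 0` under the convention «`0` if not finite» (`Ker 0 = E`, and `Nat.card` of an infinite set is `0`; `t(1) = 2`).
[cite: AlvaradoAuffarth2018, §1 («and `0` if not»)] -/
theorem natCard_kerPoints_one_sub_one_units :
    Nat.card (Hom.kerPoints (specOver ℂ ℂ) ((1 : End A) - ((1 : (End A)ˣ) : End A))) = 0 := by
  have h := natCard_kerPoints_one_sub_units hA 1
  rw [trace_units_one hA] at h
  omega

/-- **`#Fix(u) = 0 ↔ u = 1`** (`t(u) = 2` only for `u = 1`). [cite: AlvaradoAuffarth2018, §1 eq. (1)] [cite: SilvermanAEC2009, III §10 Thm. 10.1] -/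
theorem natCard_kerPoints_one_sub_units_eq_zero_iff (u : (End A)ˣ) :
    Nat.card (Hom.kerPoints (specOver ℂ ℂ) ((1 : End A) - (u : End A))) = 0 ↔ u = 1 := by
  refine ⟨fun h0 ↦ ?_, fun h1 ↦ by rw [h1]; exact natCard_kerPoints_one_sub_one_units hA⟩
  have h := natCard_kerPoints_one_sub_units hA u
  rw [h0, Nat.cast_zero] at h
  -- `t(u) = 2`: by the five-way classification only `u = 1` has trace `2`
  rcases eq_id_or_eq_neg_id_or_comp_self_eq_of_comp_eq_id hA (units_comp_inv u) with e | e | e | e | e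
  · exact Units.ext (show (u : End A) = ((1 : (End A)ˣ) : End A) from e)
  · exfalso
    have h2 := trace_units_neg_one hA
    have e' : u = -1 := Units.ext (show (u : End A) = ((-1 : (End A)ˣ) : End A) from e)
    rw [e'] at h
    omega
  · have ht := trace_eq_of_comp_self_eq_zsmul_sub_id hA (units_comp_inv u) 0 (by rw [zero_zsmul, zero_sub]; exact e)
    omega
  · have ht := trace_eq_of_comp_self_eq_zsmul_sub_id hA (units_comp_inv u) 1 (by rw [one_zsmul]; exact e)
    omega
  · have ht := trace_eq_of_comp_self_eq_zsmul_sub_id hA (units_comp_inv u) (-1) (by rw [neg_one_zsmul]; exact e)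
    omega

/-- **A non-trivial automorphism has a fixed point: `u ≠ 1 ⇒ 1 ≤ #Fix(u)`** (so `Ker(1 − u)(ℂ)` is finite and non-empty).
[cite: AlvaradoAuffarth2018, §1 eq. (1)] [cite: SilvermanAEC2009, III §10 Thm. 10.1] -/
theorem one_le_natCard_kerPoints_one_sub_units {u : (End A)ˣ} (hu : u ≠ 1) :
    1 ≤ Nat.card (Hom.kerPoints (specOver ℂ ℂ) ((1 : End A) - (u : End A))) := by
  by_contra h
  exact hu ((natCard_kerPoints_one_sub_units_eq_zero_iff hA u).1 (by omega))

/-- **`#Fix(u) ≤ 4`** (`t(u) ≥ −2`). [cite: AlvaradoAuffarth2018, §1 eq. (1)] [cite: SilvermanAEC2009, III §10 Thm. 10.1] -/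
theorem natCard_kerPoints_one_sub_units_le_four (u : (End A)ˣ) :
    Nat.card (Hom.kerPoints (specOver ℂ ℂ) ((1 : End A) - (u : End A))) ≤ 4 := by
  have h := natCard_kerPoints_one_sub_units hA u
  have hsq := trace_units_sq_le_four_of_dim_eq_one hA u
  have ht : -2 ≤ LinearMap.trace ℤ _ (singularCohomology.map ℤ ℤ (AlgPoints.mapContinuous (L := ℂ) (u : End A).hom.hom.hom) 1).hom := by
    nlinarith [hsq]
  omega

/-- **`#Fix(u⁻¹) = #Fix(u)`** (`t(u⁻¹) = t(u)`). [cite: AlvaradoAuffarth2018, §1 eq. (1)] -/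
theorem natCard_kerPoints_one_sub_units_inv (u : (End A)ˣ) :
    Nat.card (Hom.kerPoints (specOver ℂ ℂ) ((1 : End A) - ((u⁻¹ : (End A)ˣ) : End A))) =
      Nat.card (Hom.kerPoints (specOver ℂ ℂ) ((1 : End A) - (u : End A))) := by
  have h := natCard_kerPoints_one_sub_units hA u⁻¹
  rw [trace_units_inv_of_dim_eq_one hA, ← natCard_kerPoints_one_sub_units hA u] at h
  exact_mod_cast h

/-- **`#Fix(u) + #Fix(−u) = 4`** (`t(−u) = −t(u)`; e.g. `0 + 4` for `±1`, `2 + 2` for `±i`, `1 + 3` for `ζ₆, ζ₃ = −ζ₆⁻¹`… per conjugate pair).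
[cite: AlvaradoAuffarth2018, §1 eq. (1)] -/
theorem natCard_kerPoints_one_sub_units_add_neg (u : (End A)ˣ) :
    Nat.card (Hom.kerPoints (specOver ℂ ℂ) ((1 : End A) - (u : End A))) +
        Nat.card (Hom.kerPoints (specOver ℂ ℂ) ((1 : End A) - ((-u : (End A)ˣ) : End A))) = 4 := by
  have h := natCard_kerPoints_one_sub_units hA u
  have h' := natCard_kerPoints_one_sub_units hA (-u)
  rw [trace_units_neg] at h'
  omega

/-- **`#Fix(u) ∈ {0, 1, 2, 3, 4}`**, the values of `2 − t`, `t ∈ {2, 1, 0, −1, −2}` (Alvarado–Auffarth's «periodic» type for `g = 1`).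
[cite: AlvaradoAuffarth2018, §1 eq. (1) and Thm. 1.1] [cite: SilvermanAEC2009, III §10 Thm. 10.1] -/
theorem natCard_kerPoints_one_sub_units_mem (u : (End A)ˣ) :
    Nat.card (Hom.kerPoints (specOver ℂ ℂ) ((1 : End A) - (u : End A))) ∈ ({0, 1, 2, 3, 4} : Finset ℕ) := by
  have h := natCard_kerPoints_one_sub_units_le_four hA u
  simp only [Finset.mem_insert, Finset.mem_singleton]
  omega

/-- `#Fix(u¹²⁺ⁿ) = #Fix(uⁿ)`: the sequence `n ↦ #Fix(uⁿ)` is periodic (`u¹² = 1`). [cite: AlvaradoAuffarth2018, Thm. 1.1 (periodic type)] -/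
theorem natCard_kerPoints_one_sub_units_pow_add_twelve (u : (End A)ˣ) (n : ℕ) :
    Nat.card (Hom.kerPoints (specOver ℂ ℂ) ((1 : End A) - ((u ^ (n + 12) : (End A)ˣ) : End A))) =
      Nat.card (Hom.kerPoints (specOver ℂ ℂ) ((1 : End A) - ((u ^ n : (End A)ˣ) : End A))) := by
  rw [pow_add, units_pow_twelve_eq_one_of_dim_eq_one hA u, mul_one]

end DimOne

end AbelianVariety

end Literature.AlgebraicGeometry.HodgeTheory
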